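import Mathlib
import HarnessLib
import Summits.NavierStokesRegularity.NavierStokesRegularity.Theses.ImplosionDoor
import Summits.NavierStokesRegularity.NavierStokesRegularity.Theorems.ImplosionDoorSphereFluxTangency
import Summits.NavierStokesRegularity.NavierStokesRegularity.Theorems.ImplosionDoorImplosionZoom
import Summits.NavierStokesRegularity.NavierStokesRegularity.Theorems.ImplosionDoorTangentialCurlFreeTriviality
import Summits.NavierStokesRegularity.NavierStokesRegularity.Theorems.ImplosionDoorPassiveRadialVorticity

/-!
# Route `ImplosionDoor` — the rung leaf N0-`LocalTubeDoorImplosion` (item `Target`, stmt-NavierStokesRegularity-25304)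
# is a THEOREM

All four hypotheses of the route's gate-certified deciding theorem
`Theses.ImplosionDoor.closes : PassiveRadialVorticity → TangentialCurlFreeTriviality → SphereFluxTangency →
ImplosionZoom → Target` are tree theorems:
* `Theorems.implosionDoor_passiveRadialVorticity_proof` (crux K1, stmt-25305: χ-transport + far-past washout by
  Friedman's maximum principle in the Gaussian gauge);
* `Theorems.implosionDoor_tangentialCurlFreeTriviality_proof` (crux K2, stmt-25306: analytic slices + kinematic
  rigidity — harmonic 1-forms on `S²` vanish, via Bochner's identity in ambient coordinates);
* `Theorems.implosionDoor_sphereFluxTangency_proof` (support, stmt-25307);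
* `Theorems.implosionDoor_implosionZoom_proof` (support, stmt-25308).
Hence `target_proof : …Theses.ImplosionDoor.Target` — the IMPLOSION DOOR: a classical Leray–Hopf solution from a
rapidly decaying datum, locally Type I at `(x₀,T)`, whose scale-critical outward radial momentum fades in `L²` on
every bounded similarity window as `t → T⁻` (asymptotically purely imploding / sphere-tangential flow near `x₀`),
is backward bounded at `(x₀,T)`.

WHAT THIS IS NOT: not a claim about Navier–Stokes regularity (Clay).  The leaf is a regularity CRITERION about a
HYPOTHETICAL blow-up scenario (rung N0-LocalTubeDoorImplosion of the door family); it says nothing about solutions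
without the implosion hypothesis, and no summit statement is proved.
-/

noncomputable section

namespace Summit.NavierStokesRegularity.NavierStokesRegularity.Theorems.ImplosionDoorTarget

open Summit.NavierStokesRegularity.NavierStokesRegularity.Theses.ImplosionDoor
open Summit.NavierStokesRegularity.NavierStokesRegularity.Theorems

/-- **The rung leaf N0-`LocalTubeDoorImplosion` (the route's `Target`, stmt-NavierStokesRegularity-25304) is a
THEOREM**: `closes` applied to the four proved items of route ImplosionDoor (a regularity criterion for the
hypothetical imploding Type-I blow-up; no Navier–Stokes regularity statement is proved).
[cite: KochNadirashviliSereginSverak2009, Prop. 4.1; folklore] -/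
theorem target_proof :
    Summit.NavierStokesRegularity.NavierStokesRegularity.Theses.ImplosionDoor.Target :=
  closes implosionDoor_passiveRadialVorticity_proof implosionDoor_tangentialCurlFreeTriviality_proof
    implosionDoor_sphereFluxTangency_proof implosionDoor_implosionZoom_proof

end Summit.NavierStokesRegularity.NavierStokesRegularity.Theorems.ImplosionDoorTarget

end
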